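import Literature.MathematicalPhysics.QuantumManyBody.GeneralizedPoincareProofs
import Literature.MathematicalPhysics.QuantumManyBody.BoseGasHardCoreContact
import Mathlib.MeasureTheory.Integral.Marginal
import Mathlib.Analysis.Calculus.FDeriv.Pi
import HarnessLib

/-!
# Crux `GroundStateRigidity` (stmt-AtomisticToContinuum-9072), line `Sketch`:
# the registered stub `stub_neighbourPoincare` (Stub A)

Supports (does not close) stmt-AtomisticToContinuum-9072; registered stub `stub_neighbourPoincare`
(Stub A) of line Sketch, skeleton v9 (lead c5). **Neighbour Poincaré inequality in the contact
shell, absolute constant.** For a `C¹` function `φ` of `N` particle positions in `(ℝ³)^N`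
vanishing wherever some pair is at distance `≤ b`, and a fixed label `i`,
`(c/b²) ∫ 1{∃ j ≠ i, |xᵢ - xⱼ| ≤ 2b} |φ|² ≤ ∫ |∇ᵢ φ|²` with `c = 1/1000`.

Proof (elementary): freeze the other particles (`MeasureTheory.lmarginal`, one pair `(i, j)` at a
time) and work with the one-body slice `f = φ(…, xᵢ = ·, …)` on `ℝ³`, which vanishes on the ball
`B(xⱼ, b)`. For `y ∈ B(xⱼ, 2b)` the midpoint `m` of `[xⱼ, y]` lies in `B(xⱼ, b)`, so the mean value
inequality along the segment `[m, y]` (`GenPoincare.enorm_sub_le_lintegral_seg`) and Jensen give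
`|f(y)|² ≤ b² ∫₀¹ |∇f|²(m + τ(y - m)) dτ`; integrating over `y ∈ B(xⱼ, 2b)`, Tonelli, and the affine
change of variables `y ↦ xⱼ + a(y - xⱼ)` (`a = (1+τ)/2 ∈ [½, 1]`, Jacobian `a⁻³ ≤ 8`, the ball is
kept) give `∫_{B(xⱼ,2b)} |f|² ≤ 8 b² ∫_{B(xⱼ,2b)} |∇f|²`. Summing over `j ≠ i` costs an absolute
factor `125`: where `∇φ(X) ≠ 0` all particles of `X` are pairwise `≥ b` apart (`φ` vanishes on
the open core set), so at most `125` of them lie within `2b` of `xᵢ` (disjoint balls of radius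
`b/2` inside a ball of radius `5b/2`). Hence `c = 1/(8 · 125)`.
-/

noncomputable section

open MeasureTheory Filter Metric Set Function
open scoped ENNReal NNReal Topology

namespace Summit.AtomisticToContinuum.BoseEinsteinCondensation.Theorems.GroundStateRigidity

open Literature.MathematicalPhysics.QuantumManyBody.BoseGas
open Literature.MathematicalPhysics.QuantumManyBody.BoseGas.GenPoincare

namespace NeighbourPoincare

/-! ### One-body estimates on `ℝ³` -/

/-- **Affine change of variables keeping a ball**: for `0 < a ≤ 1` and measurable `H ≥ 0`,
`∫_{B(p,R)} H(a y + (1-a) p) dy ≤ a⁻³ ∫_{B(p,R)} H` (the image of the ball is inside the ball,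
and `dy = a⁻³ dz`). [folklore] -/
theorem lintegral_closedBall_comp_affine_le (p : Space) (R : ℝ) {a : ℝ} (ha0 : 0 < a)
    (ha1 : a ≤ 1) {H : Space → ℝ≥0∞} (hH : Measurable H) :
    ∫⁻ y in closedBall p R, H (a • y + (1 - a) • p) ≤
      (ENNReal.ofReal a ^ 3)⁻¹ * ∫⁻ z in closedBall p R, H z := by
  -- adapted from `GenPoincare.lintegral_cell_comp_affine_le` (cube replaced by a ball)
  set F : Space → ℝ≥0∞ := (closedBall p R).indicator H with hF
  have hFm : Measurable F := hH.indicator measurableSet_closedBall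
  have hmem : ∀ y ∈ closedBall p R, a • y + (1 - a) • p ∈ closedBall p R := fun y hy => by
    rw [mem_closedBall, dist_eq_norm] at hy ⊢
    calc ‖a • y + (1 - a) • p - p‖ = ‖a • (y - p)‖ := by congr 1; module
      _ = a * ‖y - p‖ := by rw [norm_smul, Real.norm_of_nonneg ha0.le]
      _ ≤ 1 * ‖y - p‖ := by gcongr
      _ ≤ R := by rw [one_mul]; exact hy
  calc ∫⁻ y in closedBall p R, H (a • y + (1 - a) • p)
      = ∫⁻ y, (closedBall p R).indicator (fun y => H (a • y + (1 - a) • p)) y :=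
        (lintegral_indicator measurableSet_closedBall _).symm
    _ ≤ ∫⁻ y, F (a • y + (1 - a) • p) := by
        refine lintegral_mono fun y => ?_
        by_cases hy : y ∈ closedBall p R
        · rw [indicator_of_mem hy, hF, indicator_of_mem (hmem y hy)]
        · rw [indicator_of_notMem hy]; exact bot_le
    _ = ∫⁻ y, F (a • (y + a⁻¹ • ((1 - a) • p))) := by
        refine lintegral_congr fun y => ?_
        rw [smul_add, smul_inv_smul₀ ha0.ne']
    _ = ∫⁻ y, F (a • y) := lintegral_add_right_eq_self (fun y => F (a • y)) _
    _ = (ENNReal.ofReal a ^ 3)⁻¹ * ∫⁻ z, F z := lintegral_comp_smul ha0 hFm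
    _ = (ENNReal.ofReal a ^ 3)⁻¹ * ∫⁻ z in closedBall p R, H z := by
        rw [hF, lintegral_indicator measurableSet_closedBall]

/-- The segment from the midpoint `m = p + ½(y - p)` to `y`, reparametrised from `p`:
`m + τ(y - m) = a y + (1 - a) p` with `a = (1 + τ)/2`. [folklore] -/
theorem seg_seg_half (p y : Space) (τ : ℝ) :
    seg (seg p y (1 / 2)) y τ = ((1 + τ) / 2) • y + (1 - (1 + τ) / 2) • p := by
  simp only [seg]
  module

/-- **Ray estimate.** If `f ∈ C¹(ℝ³)` vanishes on the ball `B(p, b)` and `|y - p| ≤ 2b`, then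
`|f(y)|² ≤ b² ∫₀¹ |∇f|²(m + τ(y - m)) dτ`, `m` the midpoint of `[p, y]` (mean value inequality
along `[m, y]`, `f(m) = 0`, `|y - m| ≤ b`, and Jensen). [folklore] -/
theorem ennnorm_sq_le_lintegral_seg {f : Space → ℂ} (hf : ContDiff ℝ 1 f) {p y : Space} {b : ℝ}
    (hy : dist y p ≤ 2 * b) (h0 : ∀ z, dist z p ≤ b → f z = 0) :
    (‖f y‖₊ : ℝ≥0∞) ^ 2 ≤ ENNReal.ofReal (b ^ 2) *
      ∫⁻ τ in Icc (0 : ℝ) 1, gradSqC f (seg (seg p y (1 / 2)) y τ) := by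
  set m : Space := seg p y (1 / 2) with hm
  have hb : 0 ≤ b := by linarith [dist_nonneg (x := y) (y := p)]
  have hym : y - m = (1 / 2 : ℝ) • (y - p) := by simp only [hm, seg]; module
  have hmp : m - p = (1 / 2 : ℝ) • (y - p) := by simp only [hm, seg]; module
  have hhalf : ‖(1 / 2 : ℝ) • (y - p)‖ ≤ b := by
    rw [norm_smul, Real.norm_of_nonneg (by norm_num : (0 : ℝ) ≤ 1 / 2), ← dist_eq_norm]
    linarith
  have hm0 : f m = 0 := h0 m (by rw [dist_eq_norm, hmp]; exact hhalf)
  have hmeas : Measurable fun τ : ℝ => gradNorm f (seg m y τ) :=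
    (measurable_gradNorm hf).comp (continuous_seg.comp
      (by fun_prop : Continuous fun τ : ℝ => ((m, y), τ))).measurable
  have h1 : (‖f y‖₊ : ℝ≥0∞) ≤ ENNReal.ofReal b * ∫⁻ τ in Icc (0 : ℝ) 1, gradNorm f (seg m y τ) := by
    have h := enorm_sub_le_lintegral_seg hf m y
    rw [hm0, sub_zero] at h
    refine h.trans (mul_le_mul_left ?_ _)
    rw [← ofReal_norm, hym]
    exact ENNReal.ofReal_le_ofReal hhalf
  have hsq : ∀ τ, gradNorm f (seg m y τ) ^ 2 = gradSqC f (seg m y τ) := fun τ => by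
    rw [gradNorm, ← ENNReal.rpow_natCast, ← ENNReal.rpow_mul]
    norm_num
  calc (‖f y‖₊ : ℝ≥0∞) ^ 2
      ≤ (ENNReal.ofReal b * ∫⁻ τ in Icc (0 : ℝ) 1, gradNorm f (seg m y τ)) ^ 2 :=
        pow_le_pow_left' h1 2
    _ = ENNReal.ofReal (b ^ 2) * (∫⁻ τ in Icc (0 : ℝ) 1, gradNorm f (seg m y τ)) ^ 2 := by
        rw [mul_pow, ENNReal.ofReal_pow hb]
    _ ≤ ENNReal.ofReal (b ^ 2) * ∫⁻ τ in Icc (0 : ℝ) 1, gradNorm f (seg m y τ) ^ 2 := by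
        refine mul_le_mul_right ?_ _
        have h := setLIntegral_sq_le_measure_mul volume hmeas.aemeasurable (Icc (0 : ℝ) 1)
        rwa [Real.volume_Icc, sub_zero, ENNReal.ofReal_one, one_mul] at h
    _ = ENNReal.ofReal (b ^ 2) * ∫⁻ τ in Icc (0 : ℝ) 1, gradSqC f (seg m y τ) := by
        simp_rw [hsq]

/-- **One hard ball controls the ball of twice the radius**: if `f ∈ C¹(ℝ³)` vanishes on
`B(p, b)` then `∫_{B(p,2b)} |f|² ≤ 8 b² ∫_{B(p,2b)} |∇f|²` (ray estimate, Tonelli, and the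
affine change of variables `y ↦ p + a(y - p)`, `a ∈ [½, 1]`, which keeps the ball and has
Jacobian `a⁻³ ≤ 8`). [folklore] -/
theorem setLIntegral_closedBall_sq_le {f : Space → ℂ} (hf : ContDiff ℝ 1 f) (p : Space) {b : ℝ}
    (h0 : ∀ z, dist z p ≤ b → f z = 0) :
    ∫⁻ y in closedBall p (2 * b), (‖f y‖₊ : ℝ≥0∞) ^ 2 ≤
      ENNReal.ofReal (8 * b ^ 2) * ∫⁻ y in closedBall p (2 * b), gradSqC f y := by
  set B := closedBall p (2 * b) with hB
  set I := ∫⁻ y in B, gradSqC f y with hI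
  have hG : Measurable (gradSqC f) := Dyson.measurable_gradSqC hf
  have hF : Measurable fun q : Space × ℝ =>
      gradSqC f (((1 + q.2) / 2) • q.1 + (1 - (1 + q.2) / 2) • p) :=
    hG.comp (by fun_prop : Continuous fun q : Space × ℝ =>
      ((1 + q.2) / 2) • q.1 + (1 - (1 + q.2) / 2) • p).measurable
  calc ∫⁻ y in B, (‖f y‖₊ : ℝ≥0∞) ^ 2
      ≤ ∫⁻ y in B, ENNReal.ofReal (b ^ 2) * ∫⁻ τ in Icc (0 : ℝ) 1,
          gradSqC f (((1 + τ) / 2) • y + (1 - (1 + τ) / 2) • p) := by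
        refine setLIntegral_mono' measurableSet_closedBall fun y hy => ?_
        have h := ennnorm_sq_le_lintegral_seg hf (mem_closedBall.1 hy) h0
        simpa only [seg_seg_half] using h
    _ = ENNReal.ofReal (b ^ 2) * ∫⁻ τ in Icc (0 : ℝ) 1, ∫⁻ y in B,
          gradSqC f (((1 + τ) / 2) • y + (1 - (1 + τ) / 2) • p) := by
        rw [lintegral_const_mul' _ _ ENNReal.ofReal_ne_top,
          lintegral_lintegral_swap (f := fun y τ =>
            gradSqC f (((1 + τ) / 2) • y + (1 - (1 + τ) / 2) • p)) hF.aemeasurable]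
    _ ≤ ENNReal.ofReal (b ^ 2) * ∫⁻ _ in Icc (0 : ℝ) 1, 8 * I := by
        refine mul_le_mul_right (setLIntegral_mono' measurableSet_Icc fun τ hτ => ?_) _
        have ha0 : 0 < (1 + τ) / 2 := by linarith [hτ.1]
        have ha1 : (1 + τ) / 2 ≤ 1 := by linarith [hτ.2]
        have ha2 : (1 / 2 : ℝ) ≤ (1 + τ) / 2 := by linarith [hτ.1]
        exact (lintegral_closedBall_comp_affine_le p (2 * b) ha0 ha1 hG).trans
          (mul_le_mul_left (inv_ofReal_pow_three_le ha2) _)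
    _ = ENNReal.ofReal (8 * b ^ 2) * I := by
        rw [setLIntegral_const, Real.volume_Icc, sub_zero, ENNReal.ofReal_one, mul_one, ← mul_assoc,
          ENNReal.ofReal_mul (by norm_num : (0 : ℝ) ≤ 8), ENNReal.ofReal_ofNat]
        ring

/-- **Neighbour count by volume.** If all particles are pairwise at distance `≥ a`, at most `125`
of them are within distance `2a` of a given one: the balls of radius `a/2` around them are
disjoint and lie in the ball of radius `5a/2`. [folklore] -/
theorem card_filter_dist_le_le {N : ℕ} {a : ℝ} (ha : 0 < a) {X : Config N}
    (hsep : ∀ j j' : Fin N, j ≠ j' → a ≤ dist (X j) (X j')) (i : Fin N) :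
    (Finset.univ.filter fun j => j ≠ i ∧ dist (X i) (X j) ≤ 2 * a).card ≤ 125 := by
  -- adapted from `BoseGas.card_filter_dist_lt_le` (radius `3a/2` replaced by `2a`)
  set J := Finset.univ.filter fun j => j ≠ i ∧ dist (X i) (X j) ≤ 2 * a with hJ
  have hdisj : (J : Set (Fin N)).PairwiseDisjoint fun j => ball (X j) (a / 2) := by
    intro j _ j' _ hjj'
    exact ball_disjoint_ball (by rw [add_halves]; exact hsep j j' hjj')
  have hsub : (⋃ j ∈ J, ball (X j) (a / 2)) ⊆ ball (X i) (5 * a / 2) := by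
    intro x hx
    simp only [mem_iUnion] at hx
    obtain ⟨j, hj, hx⟩ := hx
    have hj' := (Finset.mem_filter.1 hj).2.2
    rw [mem_ball] at hx ⊢
    calc dist x (X i) ≤ dist x (X j) + dist (X j) (X i) := dist_triangle _ _ _
      _ < a / 2 + 2 * a := add_lt_add_of_lt_of_le hx (by rwa [dist_comm])
      _ = 5 * a / 2 := by ring
  have hvol := measure_mono (μ := volume) hsub
  rw [measure_biUnion_finset hdisj (fun j _ => measurableSet_ball)] at hvol
  simp only [Measure.addHaar_ball volume _ (by positivity : (0 : ℝ) ≤ a / 2), Finset.sum_const,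
    nsmul_eq_mul, finrank_euclideanSpace_fin] at hvol
  rw [Measure.addHaar_ball volume _ (by positivity : (0 : ℝ) ≤ 5 * a / 2),
    finrank_euclideanSpace_fin] at hvol
  have hV0 : volume (ball (0 : Space) 1) ≠ 0 := (measure_ball_pos volume _ one_pos).ne'
  have hVt : volume (ball (0 : Space) 1) ≠ ⊤ := measure_ball_lt_top.ne
  have h2 : ENNReal.ofReal ((5 * a / 2) ^ 3) = 125 * ENNReal.ofReal ((a / 2) ^ 3) := by
    rw [show (5 * a / 2) ^ 3 = 125 * (a / 2) ^ 3 by ring, ENNReal.ofReal_mul (by norm_num)]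
    norm_num
  rw [h2, mul_assoc (125 : ℝ≥0∞)] at hvol
  have hc0 : ENNReal.ofReal ((a / 2) ^ 3) * volume (ball (0 : Space) 1) ≠ 0 :=
    mul_ne_zero (by positivity) hV0
  have hct : ENNReal.ofReal ((a / 2) ^ 3) * volume (ball (0 : Space) 1) ≠ ⊤ :=
    ENNReal.mul_ne_top ENNReal.ofReal_ne_top hVt
  have h3 : ((J.card : ℕ) : ℝ≥0∞) ≤ 125 := (ENNReal.mul_le_mul_iff_left hc0 hct).1 hvol
  exact_mod_cast h3

/-! ### Slices of `N`-body functions -/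

variable {N : ℕ}

/-- Chain rule for slices: `|∇(φ(…, xᵢ = ·, …))|²(x) = |∇ᵢ φ|²(…, x, …)`. [folklore] -/
theorem gradSqC_update {φ : Config N → ℂ} (hφ : Differentiable ℝ φ) (X : Config N) (i : Fin N)
    (x : Space) :
    gradSqC (fun y => φ (update X i y)) x =
      ∑ k : Fin 3, (‖fderiv ℝ φ (update X i x) (unitVec i k)‖₊ : ℝ≥0∞) ^ 2 := by
  -- adapted from `BoseGas.gradSqC_slice` (`PeriodicBoseGasThm31.lean`)
  unfold gradSqC
  refine Finset.sum_congr rfl fun k _ => ?_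
  have h := hasFDerivAt_update (𝕜 := ℝ) X (i := i) x
  have harg : (ContinuousLinearMap.pi (Pi.single i (ContinuousLinearMap.id ℝ Space)) :
      Space →L[ℝ] Config N) (EuclideanSpace.single k 1) = unitVec i k := by
    funext j
    by_cases hj : j = i
    · subst hj; simp [unitVec]
    · simp [hj, unitVec]
  rw [show (fun y => φ (update X i y)) = φ ∘ update X i from rfl,
    fderiv_comp x (hφ _) h.differentiableAt, h.fderiv, ContinuousLinearMap.comp_apply, harg]

/-- **The pair estimate on configuration space.** For `j ≠ i` and `φ ∈ C¹` vanishing wherever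
some pair is at distance `≤ b`:
`∫ 1{|xᵢ - xⱼ| ≤ 2b} |φ|² ≤ 8 b² ∫ 1{|xᵢ - xⱼ| ≤ 2b} |∇ᵢ φ|²` (freeze all particles but `i`
and apply the one-body estimate around `xⱼ`). [folklore] -/
theorem lintegral_pair_le {b : ℝ} {i j : Fin N} (hij : j ≠ i) {φ : Config N → ℂ}
    (hφ : ContDiff ℝ 1 φ)
    (hzero : ∀ X : Config N, (∃ j j' : Fin N, j ≠ j' ∧ dist (X j) (X j') ≤ b) → φ X = 0) :
    ∫⁻ X, {Y : Config N | dist (Y i) (Y j) ≤ 2 * b}.indicator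
        (fun Y => (‖φ Y‖₊ : ℝ≥0∞) ^ 2) X ≤
      ENNReal.ofReal (8 * b ^ 2) * ∫⁻ X, {Y : Config N | dist (Y i) (Y j) ≤ 2 * b}.indicator
        (fun Y => ∑ k : Fin 3, (‖fderiv ℝ φ Y (unitVec i k)‖₊ : ℝ≥0∞) ^ 2) X := by
  set S : Set (Config N) := {Y | dist (Y i) (Y j) ≤ 2 * b} with hS
  set G : Config N → ℝ≥0∞ := fun Y => ∑ k : Fin 3, (‖fderiv ℝ φ Y (unitVec i k)‖₊ : ℝ≥0∞) ^ 2
    with hG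
  have hSm : MeasurableSet S := measurableSet_le (measurable_dist_pair i j) measurable_const
  have hF : Measurable fun X => S.indicator (fun Y => (‖φ Y‖₊ : ℝ≥0∞) ^ 2) X :=
    (measurable_ennnormSq hφ.continuous).indicator hSm
  have hGm : Measurable G :=
    Finset.measurable_sum _ fun k _ => measurable_ennnormSq_fderiv_apply hφ _
  have hGS : Measurable fun X => ENNReal.ofReal (8 * b ^ 2) * S.indicator G X :=
    measurable_const.mul (hGm.indicator hSm)
  rw [← lintegral_const_mul _ (hGm.indicator hSm)]
  have hvol : (volume : Measure (Config N)) = Measure.pi fun _ => volume := rfl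
  rw [hvol]
  refine lintegral_le_of_lmarginal_le {i} hF hGS ?_
  rw [lmarginal_singleton, lmarginal_singleton]
  intro X
  change ∫⁻ y : Space, S.indicator (fun Y => (‖φ Y‖₊ : ℝ≥0∞) ^ 2) (update X i y) ≤
    ∫⁻ y : Space, ENNReal.ofReal (8 * b ^ 2) * S.indicator G (update X i y)
  -- the slice `f = φ(…, xᵢ = ·, …)` vanishes on the ball `B(xⱼ, b)`
  set f : Space → ℂ := fun y => φ (update X i y) with hf
  have hfC : ContDiff ℝ 1 f := hφ.comp (contDiff_update 1 X i)
  have hmemS : ∀ y, update X i y ∈ S ↔ y ∈ closedBall (X j) (2 * b) := fun y => by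
    simp [hS, mem_closedBall, update_of_ne hij]
  have h0 : ∀ z, dist z (X j) ≤ b → f z = 0 := fun z hz =>
    hzero _ ⟨i, j, hij.symm, by simpa [update_of_ne hij] using hz⟩
  have hind1 : ∀ y, S.indicator (fun Y => (‖φ Y‖₊ : ℝ≥0∞) ^ 2) (update X i y) =
      (closedBall (X j) (2 * b)).indicator (fun y => (‖f y‖₊ : ℝ≥0∞) ^ 2) y := by
    intro y
    by_cases hy : y ∈ closedBall (X j) (2 * b)
    · rw [indicator_of_mem hy, indicator_of_mem ((hmemS y).2 hy)]
    · rw [indicator_of_notMem hy, indicator_of_notMem (mt (hmemS y).1 hy)]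
  have hind2 : ∀ y, S.indicator G (update X i y) =
      (closedBall (X j) (2 * b)).indicator (gradSqC f) y := by
    intro y
    by_cases hy : y ∈ closedBall (X j) (2 * b)
    · rw [indicator_of_mem hy, indicator_of_mem ((hmemS y).2 hy),
        gradSqC_update (hφ.differentiable one_ne_zero)]
    · rw [indicator_of_notMem hy, indicator_of_notMem (mt (hmemS y).1 hy)]
  simp_rw [hind1, hind2]
  rw [lintegral_indicator measurableSet_closedBall, lintegral_const_mul' _ _ ENNReal.ofReal_ne_top,
    lintegral_indicator measurableSet_closedBall]
  exact setLIntegral_closedBall_sq_le hfC (X j) h0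

end NeighbourPoincare

/-! ### The stub -/

open NeighbourPoincare in
/-- **Stub A — neighbour Poincaré inequality in the contact shell (absolute constant).** There is
an absolute `c > 0` (`c = 1/1000`) such that for every `N`, `b > 0`, label `i` and `C¹` function
`φ` on `(ℝ³)^N` vanishing wherever some pair of particles is at distance `≤ b` (hard cores of
diameter `b`), the kinetic energy of particle `i` controls the mass of `φ` on the region where
particle `i` has a neighbour within `2b`: `(c/b²) ∫_{∃ j ≠ i, |xᵢ−xⱼ| ≤ 2b} |φ|² ≤ ∫ |∇ᵢ φ|²`.
(Pair estimate `lintegral_pair_le` summed over `j ≠ i`; where `∇φ ≠ 0` the particles are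
pairwise `≥ b` apart, so at most `125` indices `j` contribute at any point.) [folklore] -/
theorem stub_neighbourPoincare :
    ∃ c : ℝ, 0 < c ∧ ∀ (N : ℕ) (b : ℝ) (i : Fin N) (φ : Config N → ℂ), 0 < b → ContDiff ℝ 1 φ →
      (∀ X : Config N, (∃ j j' : Fin N, j ≠ j' ∧ dist (X j) (X j') ≤ b) → φ X = 0) →
      ENNReal.ofReal (c / b ^ 2) *
          ∫⁻ X, {Y : Config N | ∃ j : Fin N, j ≠ i ∧ dist (Y i) (Y j) ≤ 2 * b}.indicator
            (fun Y => (‖φ Y‖₊ : ℝ≥0∞) ^ 2) X ≤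
        ∫⁻ X, ∑ k : Fin 3,
          (‖fderiv ℝ φ X (Pi.single i (EuclideanSpace.single k (1 : ℝ)))‖₊ : ℝ≥0∞) ^ 2 := by
  refine ⟨1 / 1000, by norm_num, fun N b i φ hb hφ hzero => ?_⟩
  classical
  set S : Fin N → Set (Config N) := fun j => {Y | dist (Y i) (Y j) ≤ 2 * b} with hS
  set G : Config N → ℝ≥0∞ :=
    fun Y => ∑ k : Fin 3, (‖fderiv ℝ φ Y (unitVec i k)‖₊ : ℝ≥0∞) ^ 2 with hG
  set U : Set (Config N) := {Y | ∃ j : Fin N, j ≠ i ∧ dist (Y i) (Y j) ≤ 2 * b} with hU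
  set F : Config N → ℝ≥0∞ := fun Y => (‖φ Y‖₊ : ℝ≥0∞) ^ 2 with hF
  change ENNReal.ofReal (1 / 1000 / b ^ 2) * ∫⁻ X, U.indicator F X ≤ ∫⁻ X, G X
  have hmS : ∀ j, MeasurableSet (S j) := fun j =>
    measurableSet_le (measurable_dist_pair i j) measurable_const
  have hGm : Measurable G :=
    Finset.measurable_sum _ fun k _ => measurable_ennnormSq_fderiv_apply hφ _
  have hFm : Measurable F := measurable_ennnormSq hφ.continuous
  -- Step 1: the indicator of the union is at most the sum of the indicators
  have h1 : ∀ X, U.indicator F X ≤ ∑ j ∈ Finset.univ.erase i, (S j).indicator F X := by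
    intro X
    by_cases hX : X ∈ U
    · obtain ⟨j, hji, hd⟩ := hX
      rw [indicator_of_mem (show X ∈ U from ⟨j, hji, hd⟩)]
      have hXj : X ∈ S j := hd
      calc F X = (S j).indicator F X := (indicator_of_mem hXj F).symm
        _ ≤ ∑ j' ∈ Finset.univ.erase i, (S j').indicator F X :=
            Finset.single_le_sum (f := fun j' => (S j').indicator F X) (fun _ _ => zero_le)
              (Finset.mem_erase.2 ⟨hji, Finset.mem_univ j⟩)
    · rw [indicator_of_notMem hX]
      exact zero_le
  -- Step 2: multiplicity — where `∇φ ≠ 0`, at most `125` indices `j ≠ i` have `|xᵢ - xⱼ| ≤ 2b`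
  have h2 : ∀ X, (∑ j ∈ Finset.univ.erase i, (S j).indicator G X) ≤ 125 * G X := by
    intro X
    by_cases hD : fderiv ℝ φ X = 0
    · have hG0 : G X = 0 := by simp [hG, hD]
      have hz : ∀ j, (S j).indicator G X = 0 := fun j => by
        by_cases h : X ∈ S j
        · rw [indicator_of_mem h, hG0]
        · rw [indicator_of_notMem h]
      simp [hz]
    · have hsep : ∀ j j' : Fin N, j ≠ j' → b ≤ dist (X j) (X j') := by
        intro j j' hjj'
        by_contra hlt
        refine hD (fderiv_eq_zero_of_mem_closure hφ isOpen_coreSet (fun Y hY => ?_)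
          (mem_closure_coreSet hb hjj' (not_le.1 hlt).le))
        obtain ⟨a, a', haa', hd⟩ := hY
        exact hzero Y ⟨a, a', haa', hd.le⟩
      calc (∑ j ∈ Finset.univ.erase i, (S j).indicator G X)
          ≤ ∑ j ∈ Finset.univ.filter (fun j => j ≠ i ∧ dist (X i) (X j) ≤ 2 * b), G X := by
            rw [← Finset.sum_filter_add_sum_filter_not (Finset.univ.erase i) (fun j => X ∈ S j)]
            have hz : ∑ j ∈ (Finset.univ.erase i).filter (fun j => X ∉ S j),
                (S j).indicator G X = 0 :=
              Finset.sum_eq_zero fun j hj => indicator_of_notMem (Finset.mem_filter.1 hj).2 _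
            rw [hz, add_zero]
            refine (Finset.sum_congr rfl fun j hj =>
              indicator_of_mem (Finset.mem_filter.1 hj).2 _).le.trans ?_
            refine Finset.sum_le_sum_of_subset_of_nonneg (fun j hj => ?_) fun _ _ _ => zero_le
            simp only [Finset.mem_filter, Finset.mem_erase, Finset.mem_univ, true_and,
              and_true] at hj ⊢
            exact ⟨hj.1, hj.2⟩
        _ ≤ 125 * G X := by
            rw [Finset.sum_const, nsmul_eq_mul]
            exact mul_le_mul_left (by exact_mod_cast card_filter_dist_le_le hb hsep i) _
  -- Step 3: assemble
  have hb2 : b ^ 2 ≠ 0 := pow_ne_zero 2 hb.ne'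
  calc ENNReal.ofReal (1 / 1000 / b ^ 2) * ∫⁻ X, U.indicator F X
      ≤ ENNReal.ofReal (1 / 1000 / b ^ 2) *
          ∫⁻ X, ∑ j ∈ Finset.univ.erase i, (S j).indicator F X :=
        mul_le_mul_right (lintegral_mono h1) _
    _ = ENNReal.ofReal (1 / 1000 / b ^ 2) *
          ∑ j ∈ Finset.univ.erase i, ∫⁻ X, (S j).indicator F X := by
        rw [lintegral_finsetSum _ fun j _ => hFm.indicator (hmS j)]
    _ ≤ ENNReal.ofReal (1 / 1000 / b ^ 2) *
          ∑ j ∈ Finset.univ.erase i, ENNReal.ofReal (8 * b ^ 2) * ∫⁻ X, (S j).indicator G X := by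
        refine mul_le_mul_right (Finset.sum_le_sum fun j hj => ?_) _
        exact lintegral_pair_le (Finset.ne_of_mem_erase hj) hφ hzero
    _ = ENNReal.ofReal (1 / 1000 / b ^ 2) * ENNReal.ofReal (8 * b ^ 2) *
          ∫⁻ X, ∑ j ∈ Finset.univ.erase i, (S j).indicator G X := by
        rw [← Finset.mul_sum, lintegral_finsetSum _ fun j _ => hGm.indicator (hmS j), mul_assoc]
    _ ≤ ENNReal.ofReal (1 / 1000 / b ^ 2) * ENNReal.ofReal (8 * b ^ 2) * ∫⁻ X, 125 * G X :=
        mul_le_mul_right (lintegral_mono h2) _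
    _ = ∫⁻ X, G X := by
        rw [lintegral_const_mul _ hGm, ← mul_assoc, ← ENNReal.ofReal_mul (by positivity),
          ← ENNReal.ofReal_ofNat 125, ← ENNReal.ofReal_mul (by positivity),
          show (1 / 1000 / b ^ 2) * (8 * b ^ 2) * (125 : ℝ) = 1 by field_simp; ring,
          ENNReal.ofReal_one, one_mul]

end Summit.AtomisticToContinuum.BoseEinsteinCondensation.Theorems.GroundStateRigidity

end
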